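import Mathlib.NumberTheory.Padics.RingHoms
import Mathlib.Topology.Algebra.ContinuousMonoidHom
import Literature.GroupTheory.Abelian.PruferGroupEndomorphismRing
import HarnessLib

/-!
# The `ℤ_pˣ`-valued character of a group acting BY SCALARS on a cocyclic `p`-primary module
# (e.g. the character `ψ_𝔭 : Γ_K → ℤ_pˣ` of a CM summand `E[𝔭^∞] ≅ K_𝔭/𝒪_𝔭`, from its level-wise integer scalars)

Serre, *Abelian ℓ-adic representations* I §1.2, and every text on CM curves (Rubin, LNM 1716 §2 / Prop. 5.4: «`E[𝔭^∞] ≅ K_𝔭/𝒪_𝔭`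
with `G_K` acting via `ψ_𝔭`»; Silverman AEC III §7 for the Tate module) pass silently from «`σ` acts on the cyclic group
`M[p^k] ≅ ℤ/p^k` by an integer `N_k(σ)`» to «the character `σ ↦ lim_k N_k(σ) ∈ ℤ_pˣ`». This file performs that passage once,
for an arbitrary group `G` acting on an additive commutative group `M` such that

* (scalars) for every `σ` and `k` there is an integer `N` with `σ • x = N • x` whenever `p^k x = 0`, and
* (full levels) for every `k` there is an element of order exactly `p^k`

(the kernel-checked shape in which the tree's CM files deliver a summand, e.g. cell `bsd-print-cf2`'s `cmPrimary_structure_two`: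
«every `σ ∈ Γ_L` acts on `C[2^k]` as an INTEGER SCALAR», «`#C[2^k] = 2^k`, `C[2^k] = ℤ·g_k` cyclic»). Output:
**`exists_unitsHom_forall_smul_eq`** — a homomorphism `ψ : G →* ℤ_pˣ` with `σ • x = (ψ σ mod p^k) • x` on `p^k`-torsion `x` (the scalar
read through `ℤ_p → ℤ/p^k` as a natural number, the tree's currency for `ℤ_p`-scalars on `p`-primary groups: `DualData₂.toDual_C_smul`,
`CharTwist.exists_dualData₂_charTwist`'s `hφ`); **`unitsChar_unique`** — such a function `G → ℤ_pˣ` is unique; and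
**`exists_continuousMonoidHom_forall_smul_eq`** — for a topological group with OPEN stabilisers the character is continuous,
`ψ : G →ₜ* ℤ_pˣ`. The construction is Mathlib's for the cyclotomic character (`PadicInt.ofIntSeq` of the compatible sequence
`N_k(σ)`, `PadicInt.toZModPow_ofIntSeq_of_pow_dvd_sub`), with roots of unity replaced by the elements of order `p^k`.

Cell `bsd-print-cf2`, width seat `bsd-line-cf2-p1-w5` g2 (crux stmt-BirchSwinnertonDyer-20368, road α: the continuous character
`ψ_{W*} : Γ_K → ℤ₂ˣ` of the pinned summand `W* = W[v̄^∞]` asked for by TURNKEY-20368-pinning (c) and B15-DYADIC-EXACT §5, and the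
function `c` of the character-twist transport for the S3b′ «twist» step). No named fact, no `sorry`, no `instance`, no notation,
no new definition (existence theorems only).

## References

* [SerreAbelianLadic1968] J.-P. Serre, *Abelian ℓ-adic representations and elliptic curves* (1968), Ch. I §1.2 (ℓ-adic characters).
* [GreenbergLNM1716] R. Greenberg, LNM 1716 (1999), §2 (the character of a rank-one `𝒪_𝔭`-module).
* [Kaplansky1954] I. Kaplansky, *Infinite Abelian Groups*, §14 (scalars of `ℤ_p` on `p`-primary groups).
* [Washington1997] L. Washington, *Introduction to Cyclotomic Fields*, §13.1 (continuity of characters of profinite groups).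
-/

noncomputable section

open Filter Topology
open Literature.GroupTheory.Abelian.PruferGroup

namespace Literature.NumberTheory.GaloisRepresentations

namespace CocyclicScalar

/-! ### §1. Algebra: integer scalars on elements of order `p^k` -/

section Algebra

variable {G : Type*} [Group G] {M : Type*} [AddCommGroup M] [DistribMulAction G M] {p : ℕ} [Fact p.Prime]

omit [Fact p.Prime] in
/-- Two integers acting equally on an element of order `p^i` agree modulo `p^i`. [cite: Kaplansky1954, §14 (PDF p. 47)] -/
theorem pow_dvd_sub_of_zsmul_eq_zsmul {x : M} {i : ℕ} (hx : addOrderOf x = p ^ i) {a b : ℤ} (h : a • x = b • x) :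
    (p : ℤ) ^ i ∣ a - b := by
  have h0 : (a - b) • x = 0 := by rw [sub_smul, h, sub_self]
  have h1 := (addOrderOf_dvd_iff_zsmul_eq_zero).mpr h0
  rw [hx] at h1
  exact_mod_cast h1

omit [Fact p.Prime] in
/-- The same divisibility with the modulus written as the natural number `p^i` (the form `ZMod (p^i)` lemmas want).
[cite: Kaplansky1954, §14 (PDF p. 47)] -/
theorem natCast_pow_dvd_sub_of_zsmul_eq_zsmul {x : M} {i : ℕ} (hx : addOrderOf x = p ^ i) {a b : ℤ} (h : a • x = b • x) :
    ((p ^ i : ℕ) : ℤ) ∣ a - b := by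
  rw [Nat.cast_pow]; exact pow_dvd_sub_of_zsmul_eq_zsmul hx h

omit [Fact p.Prime] in
/-- An element of order `p^k` is killed by `p^k`. [cite: Kaplansky1954, §14 (PDF p. 47)] -/
theorem pow_nsmul_eq_zero_of_addOrderOf {x : M} {k : ℕ} (hx : addOrderOf x = p ^ k) : p ^ k • x = 0 := by
  rw [← hx]; exact addOrderOf_nsmul_eq_zero x

omit [Fact p.Prime] in
/-- … and by `p^(k+1)`. [cite: Kaplansky1954, §14 (PDF p. 47)] -/
theorem pow_succ_nsmul_eq_zero_of_addOrderOf {x : M} {k : ℕ} (hx : addOrderOf x = p ^ k) : p ^ (k + 1) • x = 0 := by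
  rw [pow_succ, mul_comm, mul_smul, pow_nsmul_eq_zero_of_addOrderOf hx, smul_zero]

omit [Fact p.Prime] in
/-- A group element commutes with integer scalars: `σ • (n • x) = n • (σ • x)`. [cite: Kaplansky1954, §14 (PDF p. 47)] -/
theorem smul_zsmul_comm (σ : G) (n : ℤ) (x : M) : σ • (n • x) = n • (σ • x) :=
  smul_comm σ n x

/-- **EXISTENCE OF THE CHARACTER.** If every `σ ∈ G` acts on the `p^k`-torsion of `M` by an integer scalar (for every `k`) and `M`
has elements of every order `p^k`, there is a homomorphism `ψ : G →* ℤ_pˣ` with `σ • x = (ψ σ mod p^k) • x` whenever `p^k x = 0`.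
(`ψ σ = lim_k N_k(σ)` à la cyclotomic character; it is a unit since `σ⁻¹` supplies the inverse scalar.)
[cite: SerreAbelianLadic1968, Ch. I §1.2] [cite: GreenbergLNM1716, §2] -/
theorem exists_unitsHom_forall_smul_eq
    (hscal : ∀ (σ : G) (k : ℕ), ∃ N : ℤ, ∀ x : M, p ^ k • x = 0 → σ • x = N • x)
    (hfull : ∀ k : ℕ, ∃ x : M, addOrderOf x = p ^ k) :
    ∃ ψ : G →* ℤ_[p]ˣ, ∀ (σ : G) (k : ℕ) (x : M), p ^ k • x = 0 →
      σ • x = (PadicInt.toZModPow k (ψ σ : ℤ_[p])).val • x := by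
  classical
  choose N hN using hscal
  choose x hx using hfull
  have hxk : ∀ k, p ^ k • x k = 0 := fun k ↦ pow_nsmul_eq_zero_of_addOrderOf (hx k)
  -- the scalars of `σ` are compatible between levels
  have hcompat : ∀ (σ : G) (i : ℕ), (p : ℤ) ^ i ∣ N σ (i + 1) - N σ i := by
    intro σ i
    apply pow_dvd_sub_of_zsmul_eq_zsmul (hx i)
    rw [← hN σ (i + 1) (x i) (pow_succ_nsmul_eq_zero_of_addOrderOf (hx i)), hN σ i (x i) (hxk i)]
  -- the limit `z σ ∈ ℤ_p` and its residues
  set z : G → ℤ_[p] := fun σ ↦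
    PadicInt.ofIntSeq _ (PadicInt.isCauSeq_padicNorm_of_pow_dvd_sub (N σ) p (hcompat σ)) with hzdef
  have hz : ∀ (σ : G) (k : ℕ), PadicInt.toZModPow k (z σ) = N σ k := fun σ k ↦
    PadicInt.toZModPow_ofIntSeq_of_pow_dvd_sub (N σ) p (hcompat σ) k
  -- `z σ` acts as `σ`
  have hact : ∀ (σ : G) (k : ℕ) (y : M), p ^ k • y = 0 → σ • y = (PadicInt.toZModPow k (z σ)).val • y := by
    intro σ k y hy
    haveI : NeZero (p ^ k) := ⟨pow_ne_zero _ (Fact.out : p.Prime).ne_zero⟩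
    rw [hz, zmod_val_intCast_smul (N σ k) hy, hN σ k y hy]
  -- multiplicativity and `z 1 = 1`, read at the elements of order `p^k`
  have hmul : ∀ σ τ : G, z (σ * τ) = z σ * z τ := by
    intro σ τ
    refine PadicInt.ext_of_toZModPow.mp fun k ↦ ?_
    rw [map_mul, hz, hz, hz, ← Int.cast_mul, ZMod.intCast_eq_intCast_iff_dvd_sub]
    refine natCast_pow_dvd_sub_of_zsmul_eq_zsmul (hx k) ?_
    have h1 : (σ * τ) • x k = (N σ k * N τ k) • x k := by
      rw [mul_smul, hN τ k (x k) (hxk k), smul_zsmul_comm, hN σ k (x k) (hxk k), smul_smul, mul_comm]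
    exact h1.symm.trans (hN (σ * τ) k (x k) (hxk k))
  have hone : z 1 = 1 := by
    refine PadicInt.ext_of_toZModPow.mp fun k ↦ ?_
    rw [hz, map_one, ← Int.cast_one, ZMod.intCast_eq_intCast_iff_dvd_sub]
    refine natCast_pow_dvd_sub_of_zsmul_eq_zsmul (hx k) ?_
    rw [one_smul, ← hN 1 k (x k) (hxk k), one_smul]
  let zHom : G →* ℤ_[p] := { toFun := z, map_one' := hone, map_mul' := hmul }
  refine ⟨zHom.toHomUnits, fun σ k y hy ↦ ?_⟩
  rw [MonoidHom.coe_toHomUnits]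
  exact hact σ k y hy

/-- **UNIQUENESS.** Two `ℤ_pˣ`-valued functions through which `G` acts on all `p^k`-torsion agree, provided `M` has elements of
every order `p^k` (they agree modulo every `p^k`). [cite: SerreAbelianLadic1968, Ch. I §1.2] -/
theorem unitsChar_unique (hfull : ∀ k : ℕ, ∃ x : M, addOrderOf x = p ^ k) {ψ ψ' : G → ℤ_[p]ˣ}
    (hψ : ∀ (σ : G) (k : ℕ) (x : M), p ^ k • x = 0 → σ • x = (PadicInt.toZModPow k (ψ σ : ℤ_[p])).val • x)
    (hψ' : ∀ (σ : G) (k : ℕ) (x : M), p ^ k • x = 0 → σ • x = (PadicInt.toZModPow k (ψ' σ : ℤ_[p])).val • x)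
    (σ : G) : ψ σ = ψ' σ := by
  apply Units.ext
  refine PadicInt.ext_of_toZModPow.mp fun k ↦ ?_
  haveI : NeZero (p ^ k) := ⟨pow_ne_zero _ (Fact.out : p.Prime).ne_zero⟩
  obtain ⟨x, hx⟩ := hfull k
  have hxk : p ^ k • x = 0 := pow_nsmul_eq_zero_of_addOrderOf hx
  have h : ((PadicInt.toZModPow k (ψ σ : ℤ_[p])).val : ℤ) • x = ((PadicInt.toZModPow k (ψ' σ : ℤ_[p])).val : ℤ) • x := by
    rw [natCast_zsmul, natCast_zsmul, ← hψ σ k x hxk, ← hψ' σ k x hxk]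
  have hd := natCast_pow_dvd_sub_of_zsmul_eq_zsmul hx h
  rw [← ZMod.intCast_eq_intCast_iff_dvd_sub] at hd
  simpa only [Int.cast_natCast, ZMod.natCast_zmod_val] using hd.symm

/-- At level `k` the residue of `ψ σ` is determined by the action on any element of order `p^k`:
if `σ • x = N • x` then `ψ σ ≡ N (mod p^k)`. [cite: SerreAbelianLadic1968, Ch. I §1.2] -/
theorem toZModPow_unitsChar_eq_of_smul_eq {ψ : G → ℤ_[p]ˣ}
    (hψ : ∀ (σ : G) (k : ℕ) (x : M), p ^ k • x = 0 → σ • x = (PadicInt.toZModPow k (ψ σ : ℤ_[p])).val • x)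
    {σ : G} {k : ℕ} {x : M} (hx : addOrderOf x = p ^ k) {N : ℤ} (hN : σ • x = N • x) :
    PadicInt.toZModPow k (ψ σ : ℤ_[p]) = N := by
  haveI : NeZero (p ^ k) := ⟨pow_ne_zero _ (Fact.out : p.Prime).ne_zero⟩
  have h : ((PadicInt.toZModPow k (ψ σ : ℤ_[p])).val : ℤ) • x = N • x := by
    rw [natCast_zsmul, ← hψ σ k x (pow_nsmul_eq_zero_of_addOrderOf hx), hN]
  have hd := natCast_pow_dvd_sub_of_zsmul_eq_zsmul hx h
  rw [← ZMod.intCast_eq_intCast_iff_dvd_sub] at hd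
  simpa only [Int.cast_natCast, ZMod.natCast_zmod_val] using hd.symm

end Algebra

/-! ### §2. Topology: open stabilisers make the character continuous -/

section Topology

variable {G : Type*} [Group G] [TopologicalSpace G] [IsTopologicalGroup G] {M : Type*} [AddCommGroup M]
  [DistribMulAction G M] {p : ℕ} [Fact p.Prime]

omit [TopologicalSpace G] [IsTopologicalGroup G] in
/-- Two group elements acting equally on an element of order `p^k` have characters congruent modulo `p^k`, hence at distance
`≤ p^{-k}`. [cite: Washington1997, §13.1] -/
theorem norm_unitsChar_sub_le_of_smul_eq {ψ : G → ℤ_[p]ˣ}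
    (hψ : ∀ (σ : G) (k : ℕ) (x : M), p ^ k • x = 0 → σ • x = (PadicInt.toZModPow k (ψ σ : ℤ_[p])).val • x)
    {k : ℕ} {x : M} (hx : addOrderOf x = p ^ k) {σ τ : G} (h : σ • x = τ • x) :
    ‖(ψ σ : ℤ_[p]) - (ψ τ : ℤ_[p])‖ ≤ (p : ℝ) ^ (-k : ℤ) := by
  haveI : NeZero (p ^ k) := ⟨pow_ne_zero _ (Fact.out : p.Prime).ne_zero⟩
  rw [PadicInt.norm_le_pow_iff_mem_span_pow, ← PadicInt.ker_toZModPow, RingHom.mem_ker, map_sub, sub_eq_zero]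
  have hτ : τ • x = ((PadicInt.toZModPow k (ψ τ : ℤ_[p])).val : ℤ) • x := by
    rw [natCast_zsmul]; exact hψ τ k x (pow_nsmul_eq_zero_of_addOrderOf hx)
  rw [toZModPow_unitsChar_eq_of_smul_eq hψ hx (h.trans hτ), Int.cast_natCast, ZMod.natCast_zmod_val]

/-- **CONTINUITY.** If the stabilisers of the points of `M` are open in the topological group `G`, a character `ψ : G →* ℤ_pˣ`
through which `G` acts on all `p^k`-torsion is continuous (the congruence class of `ψ σ` modulo `p^k` is constant on the open set
`{τ : τ • x_k = σ • x_k}`, `x_k` of order `p^k`). [cite: Washington1997, §13.1] [cite: SerreAbelianLadic1968, Ch. I §1.2] -/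
theorem continuous_unitsChar (hfull : ∀ k : ℕ, ∃ x : M, addOrderOf x = p ^ k)
    (hstab : ∀ x : M, IsOpen {σ : G | σ • x = x}) (ψ : G →* ℤ_[p]ˣ)
    (hψ : ∀ (σ : G) (k : ℕ) (x : M), p ^ k • x = 0 → σ • x = (PadicInt.toZModPow k (ψ σ : ℤ_[p])).val • x) :
    Continuous ψ := by
  -- continuity of the `ℤ_p`-valued function
  have hval : Continuous fun σ : G ↦ (ψ σ : ℤ_[p]) := by
    refine continuous_iff_continuousAt.mpr fun σ₀ ↦ ?_
    rw [ContinuousAt, Metric.tendsto_nhds]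
    intro ε hε
    obtain ⟨k, hk⟩ := PadicInt.exists_pow_neg_lt p hε
    obtain ⟨x, hx⟩ := hfull k
    have hU : {σ : G | σ • x = σ₀ • x} ∈ 𝓝 σ₀ := by
      have hopen : IsOpen ((fun σ : G ↦ σ₀⁻¹ * σ) ⁻¹' {τ : G | τ • x = x}) :=
        (hstab x).preimage (continuous_const.mul continuous_id)
      refine mem_nhds_iff.mpr ⟨(fun σ : G ↦ σ₀⁻¹ * σ) ⁻¹' {τ : G | τ • x = x}, fun σ hσ ↦ ?_, hopen, ?_⟩
      · have hσ' : (σ₀⁻¹ * σ) • x = x := hσ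
        have h2 : σ₀ • ((σ₀⁻¹ * σ) • x) = σ₀ • x := congrArg (fun y ↦ σ₀ • y) hσ'
        rw [← mul_smul, mul_inv_cancel_left] at h2
        exact h2
      · show (σ₀⁻¹ * σ₀) • x = x
        rw [inv_mul_cancel, one_smul]
    filter_upwards [hU] with σ hσ
    rw [dist_eq_norm]
    exact (norm_unitsChar_sub_le_of_smul_eq hψ hx hσ).trans_lt hk
  refine Units.continuous_iff.mpr ⟨hval, ?_⟩
  have h : (fun σ : G ↦ ((ψ σ)⁻¹ : ℤ_[p]ˣ).val) = (fun σ : G ↦ (ψ σ : ℤ_[p])) ∘ fun σ ↦ σ⁻¹ := by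
    funext σ; simp only [Function.comp_apply, map_inv]
  rw [h]
  exact hval.comp continuous_inv

/-- **THE CONTINUOUS CHARACTER OF A COCYCLIC SCALAR ACTION.** For a topological group `G` acting on `M` with open stabilisers,
by integer scalars on every `M[p^k]`, `M` having elements of every order `p^k`: there is a continuous character `ψ : G →ₜ* ℤ_pˣ` with
`σ • x = (ψ σ mod p^k) • x` on `p^k`-torsion `x` — e.g. the character `ψ_𝔭 : Γ_K →ₜ* ℤ_pˣ` of a CM summand `E[𝔭^∞] ≅ K_𝔭/𝒪_𝔭`
(`𝒪_𝔭 = ℤ_p`). [cite: SerreAbelianLadic1968, Ch. I §1.2] [cite: GreenbergLNM1716, §2] -/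
theorem exists_continuousMonoidHom_forall_smul_eq
    (hscal : ∀ (σ : G) (k : ℕ), ∃ N : ℤ, ∀ x : M, p ^ k • x = 0 → σ • x = N • x)
    (hfull : ∀ k : ℕ, ∃ x : M, addOrderOf x = p ^ k) (hstab : ∀ x : M, IsOpen {σ : G | σ • x = x}) :
    ∃ ψ : G →ₜ* ℤ_[p]ˣ, ∀ (σ : G) (k : ℕ) (x : M), p ^ k • x = 0 →
      σ • x = (PadicInt.toZModPow k (ψ σ : ℤ_[p])).val • x := by
  obtain ⟨ψ, hψ⟩ := exists_unitsHom_forall_smul_eq hscal hfull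
  exact ⟨⟨ψ, continuous_unitsChar hfull hstab ψ hψ⟩, hψ⟩

end Topology

end CocyclicScalar

end Literature.NumberTheory.GaloisRepresentations

end
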